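import Literature.Probability.Percolation.TwoClusterExchange
import HarnessLib

/-!
# The two-cut master inequality and the heavy-set exit bound with a SET sink

Support file for the crux `NoHeavyLowerTail` (stmt-CriticalPhenomena-4575; depth prover nh-dp-blobmono,
blob-quotient line).  No definitions, no named facts, no sorries.

`Theorems.twoCutMaster_le` / `Theorems.lonelyOrPair_le` (`…TwoCutMaster`) bound, for an observer `o` and
relays `a, b, c`, the probability that `o` reaches `a` or `b` but not `c` by `max(μ{a ↮ c}, μ{b ↮ c})` — one
instance of the tripod exchange inequality C⁺.  This file replaces the single sink `c` by a finite SET `T`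
of vertices (`x ↔ T` = `x` joined to some vertex of `T`, `x ↮ T` = to none):

* `twoCutMasterSet_le` — `μ( ({a↮T} ∩ {b↮T}) ∪ ({o↔a} ∩ {b↔T} ∩ {a↮T}) ∪ ({o↔b} ∩ {a↔T} ∩ {b↮T}) ) ≤ t`
  whenever `μ{a ↮ T} ≤ t` and `μ{b ↮ T} ≤ t` (`twoCutMasterSet_le_max`: the `max` form);
* `lonelyOrPairSet_le` — `μ( {o ↮ T} ∩ ({o ↔ a} ∪ {o ↔ b}) ) ≤ max(μ{a ↮ T}, μ{b ↮ T})`.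

The vertices of `T` need not be joined to each other, so this is NOT the vertex statement on a quotient
graph; the exchange step is van den Berg–Häggström–Kahn's Thm 1.5 in the event form
`Literature.Probability.Percolation.twoClusterExchange` (`s = a`, `t = b`) with the type-`(+)` events
`{a ↔ o}`, `{a ↔ T} ∩ {b ↮ T}` and the type-`(−)` events `{b ↔ T} ∩ {a ↮ T}`, `{b ↔ o}`:
`μ(oa|bT) · μ(ob|aT) ≤ μ(oaT|b) · μ(obT|a)` (`tripodExchangeSet`), the set-sink tripod exchange.

Use (blob-CIL, five blobs): with two heavy blobs `c, d` and two light blobs `a, b` jointly light, the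
minority event of the cumulative isolation lemma is `{o ↮ {c,d}} ∩ ({o↔a} ∪ {o↔b})` and its bound is
`max(μ{a ↮ {c,d}}, μ{b ↮ {c,d}}) ≤ max(μ{|π(a)| ≤ j}, μ{|π(b)| ≤ j})` (`…CILFiveBlobs`).
-/

noncomputable section

open MeasureTheory Set
open Literature.Probability.LatticeModels (prodBernoulli)
open Literature.Probability.Percolation

namespace Summit.CriticalPhenomena.PercolationContinuityZ3.Theorems

variable {V : Type*}

namespace TwoCutMasterSet

/-- **Set-sink tripod exchange** `μ(oa|bT) · μ(ob|aT) ≤ μ(oaT|b) · μ(obT|a)`: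
`μ({o↔a} ∩ {b↔T} ∩ {a↮T}) · μ({o↔b} ∩ {a↔T} ∩ {b↮T}) ≤ μ({o↔a} ∩ {a↔T} ∩ {b↮T}) · μ({o↔b} ∩ {b↔T} ∩ {a↮T})`.
One application of the two-cluster exchange inequality (BHK Thm 1.5, event form) with `s = a`, `t = b`;
the left cells lie in `{a ↮ b}` automatically. [cite: VandenbergHaggstromKahn2005, Thm. 1.5 (p. 7) — corollary] -/
theorem tripodExchangeSet [Fintype V] (w : Sym2 V → unitInterval) (o a b : V) (T : Finset V) :
    (prodBernoulli w).real ((openConn o a ∩ {ω | ∃ t ∈ T, ω ∈ (openConn b t : Set (BondConfig V))}) ∩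
        {ω | ∀ t ∈ T, ω ∉ (openConn a t : Set (BondConfig V))}) *
      (prodBernoulli w).real ((openConn o b ∩ {ω | ∃ t ∈ T, ω ∈ (openConn a t : Set (BondConfig V))}) ∩
        {ω | ∀ t ∈ T, ω ∉ (openConn b t : Set (BondConfig V))}) ≤
    (prodBernoulli w).real ((openConn o a ∩ {ω | ∃ t ∈ T, ω ∈ (openConn a t : Set (BondConfig V))}) ∩
        {ω | ∀ t ∈ T, ω ∉ (openConn b t : Set (BondConfig V))}) *
      (prodBernoulli w).real ((openConn o b ∩ {ω | ∃ t ∈ T, ω ∈ (openConn b t : Set (BondConfig V))}) ∩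
        {ω | ∀ t ∈ T, ω ∉ (openConn a t : Set (BondConfig V))}) := by
  classical
  set μ := prodBernoulli w with hμ
  by_cases hab : a = b
  · subst hab
    have h0 : (openConn o a ∩ {ω | ∃ t ∈ T, ω ∈ (openConn a t : Set (BondConfig V))}) ∩
        {ω | ∀ t ∈ T, ω ∉ (openConn a t : Set (BondConfig V))} = (∅ : Set (BondConfig V)) := by
      ext ω
      refine ⟨fun h => ?_, fun h => h.elim⟩
      obtain ⟨⟨-, t, ht, hat⟩, haT⟩ := h
      exact haT t ht hat
    rw [h0, measureReal_empty, zero_mul]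
  -- the four events of the exchange
  set A₁ : Set (BondConfig V) := openConn a o with hA₁
  set B₁ : Set (BondConfig V) := {ω | ∃ t ∈ T, ω ∈ (openConn b t : Set (BondConfig V))} ∩
    {ω | ∀ t ∈ T, ω ∉ (openConn a t : Set (BondConfig V))} with hB₁
  set A₂ : Set (BondConfig V) := {ω | ∃ t ∈ T, ω ∈ (openConn a t : Set (BondConfig V))} ∩
    {ω | ∀ t ∈ T, ω ∉ (openConn b t : Set (BondConfig V))} with hA₂
  set B₂ : Set (BondConfig V) := openConn b o with hB₂
  have hex := twoClusterExchange w hab (A₁ := A₁) (A₂ := A₂) (B₁ := B₁) (B₂ := B₂)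
    (fun ω ω' h1 h2 hω => typePlus_openConn a b o h1 h2 hω)
    (fun ω ω' h1 h2 hω => ⟨by
        obtain ⟨t, ht, hat⟩ := hω.1
        exact ⟨t, ht, typePlus_openConn a b t h1 h2 hat⟩,
      fun t ht => typePlus_not_openConn a b t h1 h2 (hω.2 t ht)⟩)
    (fun ω ω' h1 h2 hω => ⟨by
        obtain ⟨t, ht, hbt⟩ := hω.1
        exact ⟨t, ht, typeMinus_openConn a b t h1 h2 hbt⟩,
      fun t ht => typeMinus_not_openConn a b t h1 h2 (hω.2 t ht)⟩)
    (fun ω ω' h1 h2 hω => typeMinus_openConn a b o h1 h2 hω)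
  have mem : ∀ (ω : BondConfig V) (x y : V), ω ∈ (openConn x y : Set (BondConfig V)) ↔
      (openGraph ω).Reachable x y := fun _ _ _ => Iff.rfl
  -- compare the four cells with the four events on `D = {a ↮ b}`
  have h1 : μ.real ((openConn o a ∩ {ω | ∃ t ∈ T, ω ∈ (openConn b t : Set (BondConfig V))}) ∩
        {ω | ∀ t ∈ T, ω ∉ (openConn a t : Set (BondConfig V))}) ≤
      μ.real ((openConn a b)ᶜ ∩ (A₁ ∩ B₁)) := by
    refine measureReal_mono fun ω hω => ?_
    obtain ⟨⟨hoa, t, ht, hbt⟩, haT⟩ := hω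
    have hoa' : (openGraph ω).Reachable o a := hoa
    have hbt' : (openGraph ω).Reachable b t := hbt
    refine ⟨fun h => haT t ht ?_, hoa'.symm, ⟨t, ht, hbt⟩, haT⟩
    have h' : (openGraph ω).Reachable a b := h
    exact h'.trans hbt'
  have h2 : μ.real ((openConn o b ∩ {ω | ∃ t ∈ T, ω ∈ (openConn a t : Set (BondConfig V))}) ∩
        {ω | ∀ t ∈ T, ω ∉ (openConn b t : Set (BondConfig V))}) ≤
      μ.real ((openConn a b)ᶜ ∩ (A₂ ∩ B₂)) := by
    refine measureReal_mono fun ω hω => ?_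
    obtain ⟨⟨hob, t, ht, hat⟩, hbT⟩ := hω
    have hob' : (openGraph ω).Reachable o b := hob
    have hat' : (openGraph ω).Reachable a t := hat
    refine ⟨fun h => hbT t ht ?_, ⟨⟨t, ht, hat⟩, hbT⟩, hob'.symm⟩
    have h' : (openGraph ω).Reachable a b := h
    exact h'.symm.trans hat'
  have h3 : μ.real ((openConn a b)ᶜ ∩ (A₁ ∩ A₂)) ≤
      μ.real ((openConn o a ∩ {ω | ∃ t ∈ T, ω ∈ (openConn a t : Set (BondConfig V))}) ∩
        {ω | ∀ t ∈ T, ω ∉ (openConn b t : Set (BondConfig V))}) := by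
    refine measureReal_mono fun ω hω => ?_
    obtain ⟨-, hao, hA⟩ := hω
    have hao' : (openGraph ω).Reachable a o := hao
    exact ⟨⟨hao'.symm, hA.1⟩, hA.2⟩
  have h4 : μ.real ((openConn a b)ᶜ ∩ (B₁ ∩ B₂)) ≤
      μ.real ((openConn o b ∩ {ω | ∃ t ∈ T, ω ∈ (openConn b t : Set (BondConfig V))}) ∩
        {ω | ∀ t ∈ T, ω ∉ (openConn a t : Set (BondConfig V))}) := by
    refine measureReal_mono fun ω hω => ?_
    obtain ⟨-, hB, hbo⟩ := hω
    have hbo' : (openGraph ω).Reachable b o := hbo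
    exact ⟨⟨hbo'.symm, hB.1⟩, hB.2⟩
  calc _ ≤ μ.real ((openConn a b)ᶜ ∩ (A₁ ∩ B₁)) * μ.real ((openConn a b)ᶜ ∩ (A₂ ∩ B₂)) :=
        mul_le_mul h1 h2 measureReal_nonneg measureReal_nonneg
    _ ≤ μ.real ((openConn a b)ᶜ ∩ (A₁ ∩ A₂)) * μ.real ((openConn a b)ᶜ ∩ (B₁ ∩ B₂)) := hex
    _ ≤ _ := mul_le_mul h3 h4 measureReal_nonneg measureReal_nonneg

/-- The master event meets `{b ↔ T}` inside `oa|bT` and misses `oaT|b`. [folklore] -/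
theorem subset_left (o a b : V) (T : Finset V) :
    ((({ω | ∀ t ∈ T, ω ∉ (openConn a t : Set (BondConfig V))} ∩
          {ω | ∀ t ∈ T, ω ∉ (openConn b t : Set (BondConfig V))}) ∪
        ((openConn o a ∩ {ω | ∃ t ∈ T, ω ∈ (openConn b t : Set (BondConfig V))}) ∩
          {ω | ∀ t ∈ T, ω ∉ (openConn a t : Set (BondConfig V))})) ∪
        ((openConn o b ∩ {ω | ∃ t ∈ T, ω ∈ (openConn a t : Set (BondConfig V))}) ∩
          {ω | ∀ t ∈ T, ω ∉ (openConn b t : Set (BondConfig V))}) : Set (BondConfig V)) ⊆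
      ({ω | ∀ t ∈ T, ω ∉ (openConn b t : Set (BondConfig V))} \
          ((openConn o a ∩ {ω | ∃ t ∈ T, ω ∈ (openConn a t : Set (BondConfig V))}) ∩
            {ω | ∀ t ∈ T, ω ∉ (openConn b t : Set (BondConfig V))})) ∪
        ((openConn o a ∩ {ω | ∃ t ∈ T, ω ∈ (openConn b t : Set (BondConfig V))}) ∩
          {ω | ∀ t ∈ T, ω ∉ (openConn a t : Set (BondConfig V))}) := by
  intro ω hω
  rcases hω with (⟨haT, hbT⟩ | hY) | ⟨⟨hob, t, ht, hat⟩, hbT⟩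
  · left
    refine ⟨hbT, ?_⟩
    rintro ⟨⟨-, t, ht, hat⟩, -⟩
    exact haT t ht hat
  · right; exact hY
  · left
    refine ⟨hbT, ?_⟩
    rintro ⟨⟨hoa, -⟩, -⟩
    have hoa' : (openGraph ω).Reachable o a := hoa
    have hob' : (openGraph ω).Reachable o b := hob
    have hat' : (openGraph ω).Reachable a t := hat
    exact hbT t ht ((hob'.symm.trans hoa').trans hat')

/-- Symmetrically, the master event meets `{a ↔ T}` inside `ob|aT` and misses `obT|a`. [folklore] -/
theorem subset_right (o a b : V) (T : Finset V) :
    ((({ω | ∀ t ∈ T, ω ∉ (openConn a t : Set (BondConfig V))} ∩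
          {ω | ∀ t ∈ T, ω ∉ (openConn b t : Set (BondConfig V))}) ∪
        ((openConn o a ∩ {ω | ∃ t ∈ T, ω ∈ (openConn b t : Set (BondConfig V))}) ∩
          {ω | ∀ t ∈ T, ω ∉ (openConn a t : Set (BondConfig V))})) ∪
        ((openConn o b ∩ {ω | ∃ t ∈ T, ω ∈ (openConn a t : Set (BondConfig V))}) ∩
          {ω | ∀ t ∈ T, ω ∉ (openConn b t : Set (BondConfig V))}) : Set (BondConfig V)) ⊆
      ({ω | ∀ t ∈ T, ω ∉ (openConn a t : Set (BondConfig V))} \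
          ((openConn o b ∩ {ω | ∃ t ∈ T, ω ∈ (openConn b t : Set (BondConfig V))}) ∩
            {ω | ∀ t ∈ T, ω ∉ (openConn a t : Set (BondConfig V))})) ∪
        ((openConn o b ∩ {ω | ∃ t ∈ T, ω ∈ (openConn a t : Set (BondConfig V))}) ∩
          {ω | ∀ t ∈ T, ω ∉ (openConn b t : Set (BondConfig V))}) := by
  intro ω hω
  rcases hω with (⟨haT, hbT⟩ | ⟨⟨hoa, t, ht, hbt⟩, haT⟩) | hZ
  · left
    refine ⟨haT, ?_⟩
    rintro ⟨⟨-, t, ht, hbt⟩, -⟩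
    exact hbT t ht hbt
  · left
    refine ⟨haT, ?_⟩
    rintro ⟨⟨hob, -⟩, -⟩
    have hoa' : (openGraph ω).Reachable o a := hoa
    have hob' : (openGraph ω).Reachable o b := hob
    have hbt' : (openGraph ω).Reachable b t := hbt
    exact haT t ht ((hoa'.symm.trans hob').trans hbt')
  · right; exact hZ

end TwoCutMasterSet

open TwoCutMasterSet in
/-- **Master two-cut inequality with a set sink (slack form).**  For an observer `o`, relays `a, b` and a
finite set `T` of vertices: if `μ{a ↮ T} ≤ t` and `μ{b ↮ T} ≤ t` then
`μ( ({a↮T} ∩ {b↮T}) ∪ ({o↔a} ∩ {b↔T} ∩ {a↮T}) ∪ ({o↔b} ∩ {a↔T} ∩ {b↮T}) ) ≤ t`.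
One set-sink tripod exchange (`TwoCutMasterSet.tripodExchangeSet`). [folklore] -/
theorem twoCutMasterSet_le [Fintype V] (w : Sym2 V → unitInterval) (o a b : V) (T : Finset V) (t : ℝ)
    (haT : (prodBernoulli w).real {ω | ∀ t ∈ T, ω ∉ (openConn a t : Set (BondConfig V))} ≤ t)
    (hbT : (prodBernoulli w).real {ω | ∀ t ∈ T, ω ∉ (openConn b t : Set (BondConfig V))} ≤ t) :
    (prodBernoulli w).real
      ((({ω | ∀ t ∈ T, ω ∉ (openConn a t : Set (BondConfig V))} ∩
            {ω | ∀ t ∈ T, ω ∉ (openConn b t : Set (BondConfig V))}) ∪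
          ((openConn o a ∩ {ω | ∃ t ∈ T, ω ∈ (openConn b t : Set (BondConfig V))}) ∩
            {ω | ∀ t ∈ T, ω ∉ (openConn a t : Set (BondConfig V))})) ∪
        ((openConn o b ∩ {ω | ∃ t ∈ T, ω ∈ (openConn a t : Set (BondConfig V))}) ∩
          {ω | ∀ t ∈ T, ω ∉ (openConn b t : Set (BondConfig V))})) ≤ t := by
  classical
  set μ := prodBernoulli w with hμ
  set NA : Set (BondConfig V) := {ω | ∀ t ∈ T, ω ∉ (openConn a t : Set (BondConfig V))} with hNA
  set NB : Set (BondConfig V) := {ω | ∀ t ∈ T, ω ∉ (openConn b t : Set (BondConfig V))} with hNB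
  set JA : Set (BondConfig V) := {ω | ∃ t ∈ T, ω ∈ (openConn a t : Set (BondConfig V))} with hJA
  set JB : Set (BondConfig V) := {ω | ∃ t ∈ T, ω ∈ (openConn b t : Set (BondConfig V))} with hJB
  set E1 : Set (BondConfig V) := (openConn o a ∩ JB) ∩ NA with hE1
  set E2 : Set (BondConfig V) := (openConn o b ∩ JA) ∩ NB with hE2
  set E3 : Set (BondConfig V) := (openConn o a ∩ JA) ∩ NB with hE3
  set E4 : Set (BondConfig V) := (openConn o b ∩ JB) ∩ NA with hE4
  set L : Set (BondConfig V) := ((NA ∩ NB) ∪ E1) ∪ E2 with hL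
  have hC : μ.real E1 * μ.real E2 ≤ μ.real E3 * μ.real E4 := tripodExchangeSet w o a b T
  have hE3sub : E3 ⊆ NB := fun ω hω => hω.2
  have hE4sub : E4 ⊆ NA := fun ω hω => hω.2
  have h1 : μ.real L ≤ μ.real NB - μ.real E3 + μ.real E1 :=
    calc μ.real L ≤ μ.real ((NB \ E3) ∪ E1) := measureReal_mono (subset_left o a b T)
      _ ≤ μ.real (NB \ E3) + μ.real E1 := measureReal_union_le _ _
      _ = μ.real NB - μ.real E3 + μ.real E1 := by
          rw [measureReal_sdiff hE3sub MeasurableSet.of_discrete]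
  have h2 : μ.real L ≤ μ.real NA - μ.real E4 + μ.real E2 :=
    calc μ.real L ≤ μ.real ((NA \ E4) ∪ E2) := measureReal_mono (subset_right o a b T)
      _ ≤ μ.real (NA \ E4) + μ.real E2 := measureReal_union_le _ _
      _ = μ.real NA - μ.real E4 + μ.real E2 := by
          rw [measureReal_sdiff hE4sub MeasurableSet.of_discrete]
  have hE3' : 0 ≤ μ.real E3 := measureReal_nonneg
  have hE4' : 0 ≤ μ.real E4 := measureReal_nonneg
  by_contra hlt
  push Not at hlt
  have h31 : μ.real E3 < μ.real E1 := by linarith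
  have h42 : μ.real E4 < μ.real E2 := by linarith
  have : μ.real E3 * μ.real E4 < μ.real E1 * μ.real E2 := mul_lt_mul'' h31 h42 hE3' hE4'
  linarith

/-- **Master two-cut inequality with a set sink (max form).** [folklore] -/
theorem twoCutMasterSet_le_max [Fintype V] (w : Sym2 V → unitInterval) (o a b : V) (T : Finset V) :
    (prodBernoulli w).real
      ((({ω | ∀ t ∈ T, ω ∉ (openConn a t : Set (BondConfig V))} ∩
            {ω | ∀ t ∈ T, ω ∉ (openConn b t : Set (BondConfig V))}) ∪
          ((openConn o a ∩ {ω | ∃ t ∈ T, ω ∈ (openConn b t : Set (BondConfig V))}) ∩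
            {ω | ∀ t ∈ T, ω ∉ (openConn a t : Set (BondConfig V))})) ∪
        ((openConn o b ∩ {ω | ∃ t ∈ T, ω ∈ (openConn a t : Set (BondConfig V))}) ∩
          {ω | ∀ t ∈ T, ω ∉ (openConn b t : Set (BondConfig V))})) ≤
      max ((prodBernoulli w).real {ω | ∀ t ∈ T, ω ∉ (openConn a t : Set (BondConfig V))})
        ((prodBernoulli w).real {ω | ∀ t ∈ T, ω ∉ (openConn b t : Set (BondConfig V))}) :=
  twoCutMasterSet_le w o a b T _ (le_max_left _ _) (le_max_right _ _)

/-- The heavy-set exit event lies in the master event: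
`{o ↮ T} ∩ ({o↔a} ∪ {o↔b}) ⊆ ({a↮T} ∩ {b↮T}) ∪ oa|bT ∪ ob|aT`. [folklore] -/
theorem lonelyOrPairSet_subset_master (o a b : V) (T : Finset V) :
    ({ω | ∀ t ∈ T, ω ∉ (openConn o t : Set (BondConfig V))} ∩ (openConn o a ∪ openConn o b) :
        Set (BondConfig V)) ⊆
      (({ω | ∀ t ∈ T, ω ∉ (openConn a t : Set (BondConfig V))} ∩
            {ω | ∀ t ∈ T, ω ∉ (openConn b t : Set (BondConfig V))}) ∪
          ((openConn o a ∩ {ω | ∃ t ∈ T, ω ∈ (openConn b t : Set (BondConfig V))}) ∩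
            {ω | ∀ t ∈ T, ω ∉ (openConn a t : Set (BondConfig V))})) ∪
        ((openConn o b ∩ {ω | ∃ t ∈ T, ω ∈ (openConn a t : Set (BondConfig V))}) ∩
          {ω | ∀ t ∈ T, ω ∉ (openConn b t : Set (BondConfig V))}) := by
  classical
  intro ω hω
  obtain ⟨hoT, hoab⟩ := hω
  have mem : ∀ x y : V, ω ∈ (openConn x y : Set (BondConfig V)) ↔ (openGraph ω).Reachable x y :=
    fun _ _ => Iff.rfl
  rcases hoab with hoa | hob
  · have hoa' : (openGraph ω).Reachable o a := hoa
    have haT : ∀ t ∈ T, ω ∉ (openConn a t : Set (BondConfig V)) := fun t ht hat =>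
      hoT t ht ((mem o t).2 (hoa'.trans ((mem a t).1 hat)))
    by_cases hbT : ∃ t ∈ T, ω ∈ (openConn b t : Set (BondConfig V))
    · exact Or.inl (Or.inr ⟨⟨hoa, hbT⟩, haT⟩)
    · push Not at hbT
      exact Or.inl (Or.inl ⟨haT, hbT⟩)
  · have hob' : (openGraph ω).Reachable o b := hob
    have hbT : ∀ t ∈ T, ω ∉ (openConn b t : Set (BondConfig V)) := fun t ht hbt =>
      hoT t ht ((mem o t).2 (hob'.trans ((mem b t).1 hbt)))
    by_cases haT : ∃ t ∈ T, ω ∈ (openConn a t : Set (BondConfig V))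
    · exact Or.inr ⟨⟨hob, haT⟩, hbT⟩
    · push Not at haT
      exact Or.inl (Or.inl ⟨haT, hbT⟩)

/-- **Heavy-set exit bound.**  For an observer `o`, relays `a, b` and a finite set `T` of vertices:
`μ( {o ↮ T} ∩ ({o ↔ a} ∪ {o ↔ b}) ) ≤ max(μ{a ↮ T}, μ{b ↮ T})` — the probability that `o` reaches `a`
or `b` but no vertex of `T` is at most the worse of the two cuts from `T`.  `T = {c}` is
`Theorems.lonelyOrPair_le_max`. [folklore] -/
theorem lonelyOrPairSet_le_max [Fintype V] (w : Sym2 V → unitInterval) (o a b : V) (T : Finset V) :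
    (prodBernoulli w).real
        ({ω | ∀ t ∈ T, ω ∉ (openConn o t : Set (BondConfig V))} ∩ (openConn o a ∪ openConn o b)) ≤
      max ((prodBernoulli w).real {ω | ∀ t ∈ T, ω ∉ (openConn a t : Set (BondConfig V))})
        ((prodBernoulli w).real {ω | ∀ t ∈ T, ω ∉ (openConn b t : Set (BondConfig V))}) :=
  (measureReal_mono (lonelyOrPairSet_subset_master o a b T)).trans (twoCutMasterSet_le_max w o a b T)

end Summit.CriticalPhenomena.PercolationContinuityZ3.Theorems

end
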